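import Summits.BirchSwinnertonDyer.BirchSwinnertonDyer.Theorems.SchneiderFreeUpperSocketsSplit
import Summits.BirchSwinnertonDyer.Rank1Residual.X11b.Three.StepLAtThree
import Literature.NumberTheory.QuadraticFields.KroneckerSplitting
import Literature.NumberTheory.QuadraticFields.BinaryQuadraticFormsPrimeRepresentation
import HarnessLib
import HarnessLib.Audit.Tags

/-!
# Schneider-free additive X3 door, SECOND WING — the upper sockets LOCALISED AT ONE FIELD `K`, and the twist-unit
# field datum OFF THE `d_K = −3` SLIVER (Theses-free): the vocabulary that removes `stub_sliverUpper`

Cell `bsd-schneider-ideate`, seat `bsd-schneider-door-c5` (prover, generation 10). WHY: the wing's per-curve glue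
`Upper.missingUpperBoundAt_of_goodMemberCoStepL_of_twistUnitField` (p489359) consumes the co-chain member's co-STEP L
ONLY at the twist-unit field `K` delivered by `Upper.TwistUnitFieldAt W p` — yet the class-wide co-socket / co-STEP L
predicates `Upper.AdditiveIMCUpperBDPInputManinAt W p` / `Upper.AdditiveCoStepLInputManinAt W p` range over EVERY socket
field, including `K = ℚ(√−3)` at `p ≥ 5`, `p ≡ 1 (mod 3)`, which lies outside Keller–Yin's Assumption 2.0.3 and
Castella–Hsieh's `u_K = 1` (referee g31: the carve-out is forced) and is therefore carried as the separate
outside-print stub `KYRead.KYReadSliverUpper`. Localising the predicates at `K` and asking the twist-unit field to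
have `d_K ≠ −3` (free in the census; automatic at `p = 3` since `3 ∣ N_W` splits in `K`) removes that stub from the
sibling route's r3 «for free». This file is the Theses-free vocabulary; the glue is the sibling
`…AdditiveX3UpperWingField.lean`.

* §1 `AdditiveCoStepLInputManinAtField W p K`, `AdditiveIMCUpperBDPInputManinAtField W p K` — VERBATIM the bodies of
  `AdditiveCoStepLInputManinAt` / `AdditiveIMCUpperBDPInputManinAt` (p480159) with the field `K` pulled OUT of the
  binder list; `…_of_inputManinAt` (class-wide ⇒ at every `K`); U27 localised:
  `additiveCoStepLInputManinAtField_of_kolyvagin_of_control_of_imcUpperField`.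
* §2 `TwistUnitFieldOffSliverAt W p` — VERBATIM `TwistUnitFieldAt W p` (p488694) with `NumberField.discr K ≠ -3`
  added; `twistUnitFieldAt_of_offSliver`; `twistUnitFieldOffSliverAt_of_twistUnitFieldAt_three` (at `p = 3` the
  two data coincide on the door: `3 ∣ N_W` splits in `K`, so `3 ∤ d_K`); (appended)
  `twistUnitFieldOffSliverAt_of_twistUnitFieldAt_of_mod_three_eq_two` (same for every `p ≡ 2 (mod 3)`: `p` split in
  `ℚ(√−3)` would force `p ≡ 1 (mod 3)`) — so the extra conjunct bites only for `p ≡ 1 (mod 3)`, `p ≥ 7`.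

HONEST FRAMING: predicates (conjecture-tagged, nothing asserted) and bookkeeping theorems; closes no item; BSD is
not advanced; an ARCHITECTURE OFFER to the planner (P2, sibling route `SchneiderFreeAdditiveX3Upper`, U25 pending):
adopt the `K`-local co-socket + off-sliver certificate and `stub_sliverUpper` disappears from the r3 skeleton.

References: [JetchevSkinnerWan2017] §7.4.1; [KellerYin2024b] Assumption 2.0.3, Thm. 3.5.1; [Gross1991] Thm. 1.3;
[Miller2011LMS] Def. 1.1; [KrizLi2019] Thm. 1.20 (shape of the twist-unit datum).
-/

noncomputable section

open scoped Classical

open WeierstrassCurve NumberField IsDedekindDomain Field Literature.NumberTheory.EllipticCurves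
  Literature.NumberTheory.EllipticCurves.ModularForms Literature.NumberTheory.EllipticCurves.GreenbergSelmer
  Literature.NumberTheory.EllipticCurves.Rank1Residual Literature.NumberTheory.EllipticCurves.Rank1Residual.Typed
  Literature.NumberTheory.GaloisRepresentations
  Summit.BirchSwinnertonDyer.Rank1Residual Summit.BirchSwinnertonDyer.Rank1Residual.Additive
  Summit.BirchSwinnertonDyer.Rank1Residual.X11b Summit.BirchSwinnertonDyer.Rank1Residual.X11b.AcSelmer
  Summit.BirchSwinnertonDyer.Rank1Residual.X11b.Halves Summit.BirchSwinnertonDyer.BirchSwinnertonDyer.Theorems.SchneiderFree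

set_option linter.dupNamespace false
set_option autoImplicit false

namespace Summit.BirchSwinnertonDyer.BirchSwinnertonDyer.Theorems.SchneiderFree.Upper

/-! ### §1 The upper sockets at ONE field `K` -/

/-- **co-STEP L♯ at the field `K`** — the body of `AdditiveCoStepLInputManinAt W p` (p480159) with `K` pulled out:
at every Heegner/parametrisation datum of `W` OVER `K` on the B6 locus with `E(K)[p] = 0`,
`IndexUpperBoundLeAt W p K P (v_p c)`. A predicate; nothing asserted. [cite: JetchevSkinnerWan2017, §7.4.1] -/
@[conjecture]
def AdditiveCoStepLInputManinAtField (W : WeierstrassCurve ℚ) [W.IsElliptic] [W.IsGloballyMinimal] (p : ℕ)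
    [Fact p.Prime] (K : Type) [Field K] [NumberField K] : Prop :=
  ∀ (N : ℕ) [NeZero N] (Dt : ModularParametrizationData W N) (H : HeegnerDatum N (NumberField.discr K))
    (ι : K →+* ℂ) (P : (W.baseChange K).toAffine.Point),
    W.analyticRank = 1 → Additive.N10.Locus W p → W.conductorNorm ℤ = N → IsImaginaryQuadratic K →
    Odd (NumberField.discr K) → ¬ p ∣ Units.torsionOrder K → SatisfiesHeegnerHypothesis N K →
    (W.quadraticTwist (NumberField.discr K : ℚ)).entireLFunction 1 ≠ 0 →
    WeierstrassCurve.Affine.Point.map ι.toRatAlgHom P = heegnerPointComplex Dt H →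
    ¬ IsOfFinAddOrder P → (∀ Q : (W.baseChange K).toAffine.Point, p • Q = 0 → Q = 0) →
    IndexUpperBoundLeAt W p K P (padicValNat p Dt.c.natAbs)

/-- **co-T-B6-1♯ at the field `K`** — the body of `AdditiveIMCUpperBDPInputManinAt W p` (p480159) with `K` pulled
out: at every datum OVER `K` and every anticyclotomic frame, `AdditiveIMCUpperBDPOnTreeLeAt p κ 𝔭 γ ι (v_p c) P`.
A predicate; nothing asserted. [cite: JetchevSkinnerWan2017, §7.4.1] [cite: KellerYin2024b, Thm. 3.5.1] -/
@[conjecture]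
def AdditiveIMCUpperBDPInputManinAtField (W : WeierstrassCurve ℚ) [W.IsElliptic] [W.IsGloballyMinimal] (p : ℕ)
    [Fact p.Prime] (K : Type) [Field K] [NumberField K] : Prop :=
  ∀ (N : ℕ) [NeZero N] (Dt : ModularParametrizationData W N) (H : HeegnerDatum N (NumberField.discr K))
    (ι : K →+* ℂ) (P : (W.baseChange K).toAffine.Point),
    W.analyticRank = 1 → Additive.N10.Locus W p → W.conductorNorm ℤ = N → IsImaginaryQuadratic K →
    Odd (NumberField.discr K) → ¬ p ∣ Units.torsionOrder K → SatisfiesHeegnerHypothesis N K →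
    (W.quadraticTwist (NumberField.discr K : ℚ)).entireLFunction 1 ≠ 0 →
    WeierstrassCurve.Affine.Point.map ι.toRatAlgHom P = heegnerPointComplex Dt H →
    ¬ IsOfFinAddOrder P → (∀ Q : (W.baseChange K).toAffine.Point, p • Q = 0 → Q = 0) →
    ∀ (κ : ZpExtension K p), κ.IsAnticyclotomic →
      ∀ (γ : Field.absoluteGaloisGroup K) [Fact (κ.IsTopGenerator γ)]
        (𝔭 : HeightOneSpectrum (𝓞 K)) (h𝔭 : ((p : ℕ) : 𝓞 K) ∈ 𝔭.asIdeal)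
        (he : 𝔭.asIdeal.ramificationIdx (𝓞 ℚ) = 1) (hf : 𝔭.asIdeal.inertiaDeg (𝓞 ℚ) = 1),
        AdditiveIMCUpperBDPOnTreeLeAt p κ 𝔭 γ (embAt K p 𝔭 h𝔭 he hf) (padicValNat p Dt.c.natAbs) P

section Field

variable {W : WeierstrassCurve ℚ} [W.IsElliptic] [W.IsGloballyMinimal] {p : ℕ} [Fact p.Prime]

/-- The class-wide co-STEP L♯ input is the field-local one at every field. [folklore] -/
theorem additiveCoStepLInputManinAtField_of_inputManinAt (h : AdditiveCoStepLInputManinAt W p)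
    (K : Type) [Field K] [NumberField K] : AdditiveCoStepLInputManinAtField W p K :=
  fun N _ Dt H ι P ↦ h N K Dt H ι P

/-- The class-wide co-socket is the field-local one at every field. [folklore] -/
theorem additiveIMCUpperBDPInputManinAtField_of_inputManinAt (h : AdditiveIMCUpperBDPInputManinAt W p)
    (K : Type) [Field K] [NumberField K] : AdditiveIMCUpperBDPInputManinAtField W p K :=
  fun N _ Dt H ι P ↦ h N K Dt H ι P

/-- The field-local inputs at every field give back the class-wide ones. [folklore] -/
theorem additiveIMCUpperBDPInputManinAt_of_forall_field
    (h : ∀ (K : Type) [Field K] [NumberField K], AdditiveIMCUpperBDPInputManinAtField W p K) :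
    AdditiveIMCUpperBDPInputManinAt W p :=
  fun N _ K _ _ Dt H ι P ↦ h K N Dt H ι P

/-- **co-T-B6-1♯ at `K` ⟹ co-STEP L♯ at `K`** (U27 localised), given Kolyvagin for `W` and the Manin-robust control
input: a frame exists (anticyclotomic `κ` with a topological generator; a degree-one `𝔭 ∣ p`, `p ∣ N_E` being split
in the Heegner field), then `indexUpperBoundLeAt_of_imcUpperLe_of_control`. VERBATIM the proof of
`additiveCoStepLInputManinAt_of_kolyvagin_of_control_of_imcUpper` at one field.
[cite: JetchevSkinnerWan2017, §7.4.1 (arXiv:1512.06894 p. 30)] [cite: Gross1991, Thm. 1.3] -/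
theorem additiveCoStepLInputManinAtField_of_kolyvagin_of_control_of_imcUpperField
    (hKo : ∀ (N : ℕ) [NeZero N] (K : Type) [Field K] [NumberField K], kolyvagin N W K)
    (h4 : AdditiveControlInputManinAt W p) {K : Type} [Field K] [NumberField K]
    (h1 : AdditiveIMCUpperBDPInputManinAtField W p K) : AdditiveCoStepLInputManinAtField W p K := by
  intro N _ Dt H ι P hr hloc hN hK hodd hunit hHe hLd hP hnt htf
  have hp : p.Prime := Fact.out
  have hfin : (W.baseChange K).ShaFinite := (hKo N K hK hHe ⟨Dt, H, ι, hP⟩ hnt).2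
  -- `p` is additive, so `p ∣ N_E`, so `p` splits in the Heegner field `K`
  have hpN : p ∣ W.conductorNorm ℤ :=
    (W.dvd_conductorNorm_iff_not_hasGoodReductionAtPrime p).mpr (not_good_of_addv W p hloc.2.1)
  have hsplit : SplitsIn K p := hHe p hp (hN ▸ hpN)
  -- a frame: anticyclotomic `κ`, topological generator `γ`, degree-one `𝔭 ∣ p`
  obtain ⟨κ, γ, -, hκ, hγ, -⟩ := X11b.exists_anticyclotomic_generator_prime (p := p) hK
  haveI : Fact (κ.IsTopGenerator γ) := ⟨hγ⟩
  obtain ⟨𝔭, h𝔭, he, hf⟩ := X11b.exists_degreeOnePrime_of_splitsIn K p hK.1 hsplit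
  exact indexUpperBoundLeAt_of_imcUpperLe_of_control hN hK hHe hfin
    (h1 N Dt H ι P hr hloc hN hK hodd hunit hHe hLd hP hnt htf κ hκ γ 𝔭 h𝔭 he hf)
    (h4 N K Dt H ι P hr hloc hN hK hodd hunit hHe hLd hP hnt κ hκ γ 𝔭 h𝔭 he hf)

end Field

/-! ### §2 The twist-unit field datum OFF the `d_K = −3` sliver -/

/-- **The SPLIT twist-unit field datum with `d_K ≠ −3`** — VERBATIM `TwistUnitFieldAt W p` (P2 gen 13 Sketch §10,
p488694) with ONE conjunct added, `NumberField.discr K ≠ -3`: an imaginary quadratic field `K` of odd discriminant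
`≠ −3`, Heegner for `N_W`, with `L(W^{d_K}, 1) ≠ 0`, a member `W₂ ∼ W`, a globally minimal model `W₂d` of
`W₂^{d_K}` and a rational `#Ш(W₂d)_an` with `ord_p ≤ 0`. At `p = 3` on the door the conjunct is automatic
(`twistUnitFieldOffSliverAt_of_twistUnitFieldAt_three`); at `p ≥ 5` it is a free choice of `K ≠ ℚ(√−3)` in the
certificate. A predicate; nothing asserted. [cite: KrizLi2019, Thm. 1.20 (shape)] [cite: Miller2011LMS, Def. 1.1] -/
@[conjecture]
def TwistUnitFieldOffSliverAt (W : WeierstrassCurve ℚ) [W.IsElliptic] (p : ℕ) [Fact p.Prime] : Prop :=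
  ∃ (K : Type) (_ : Field K) (_ : NumberField K) (W₂ W₂d : WeierstrassCurve ℚ) (_ : W₂.IsElliptic)
    (_ : W₂.IsGloballyMinimal) (_ : W₂d.IsElliptic) (_ : W₂d.IsGloballyMinimal),
    IsImaginaryQuadratic K ∧ Odd (NumberField.discr K) ∧ NumberField.discr K ≠ -3 ∧
    SatisfiesHeegnerHypothesis (W.conductorNorm ℤ) K ∧
    (W.quadraticTwist (NumberField.discr K : ℚ)).entireLFunction 1 ≠ 0 ∧
    IsIsogenous W W₂ ∧ (∃ C : VariableChange ℚ, C • W₂.quadraticTwist (NumberField.discr K : ℚ) = W₂d) ∧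
    ∃ qd : ℚ, shaAn W₂d = (qd : ℂ) ∧ padicValRat p qd ≤ 0

/-- The off-sliver datum is a split twist-unit field datum. [folklore] -/
theorem twistUnitFieldAt_of_offSliver {W : WeierstrassCurve ℚ} [W.IsElliptic] {p : ℕ} [Fact p.Prime]
    (h : TwistUnitFieldOffSliverAt W p) : TwistUnitFieldAt W p := by
  obtain ⟨K, _, _, W₂, W₂d, _, _, _, _, hK, hodd, -, hHH, hLd, h2, hC, hU⟩ := h
  exact ⟨K, inferInstance, inferInstance, W₂, W₂d, inferInstance, inferInstance, inferInstance, inferInstance, hK,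
    hodd, hHH, hLd, h2, hC, hU⟩

/-- **At `p = 3` on the door the sliver is empty**: if `3 ∣ N_W` (the door's `p` is additive) then every split
twist-unit field datum is off the sliver — `3` splits in the Heegner field `K`, so `3 ∤ d_K`
(`X11b.Three.not_dvd_discr_and_not_dvd_torsionOrder_of_heegner`), hence `d_K ≠ −3`. [folklore] -/
theorem twistUnitFieldOffSliverAt_of_twistUnitFieldAt_three {W : WeierstrassCurve ℚ} [W.IsElliptic]
    [Fact (3 : ℕ).Prime] (h3N : 3 ∣ W.conductorNorm ℤ) (h : TwistUnitFieldAt W 3) :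
    TwistUnitFieldOffSliverAt W 3 := by
  obtain ⟨K, _, _, W₂, W₂d, _, _, _, _, hK, hodd, hHH, hLd, h2, hC, hU⟩ := h
  have hpd : ¬ ((3 : ℕ) : ℤ) ∣ NumberField.discr K :=
    (X11b.Three.not_dvd_discr_and_not_dvd_torsionOrder_of_heegner hK hHH (by norm_num) h3N).1
  have hne : NumberField.discr K ≠ -3 := fun h ↦ hpd (by rw [h]; norm_num)
  exact ⟨K, inferInstance, inferInstance, W₂, W₂d, inferInstance, inferInstance, inferInstance, inferInstance, hK,
    hodd, hne, hHH, hLd, h2, hC, hU⟩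


/-- **For odd `p ≡ 2 (mod 3)` on the door the sliver is empty too**: if `p ∣ N_W` (additive `p`) then every split
twist-unit field datum is off the sliver — `p` splits in the Heegner field `K`, i.e. `(d_K / p) = 1`
(`ncard_primesOver_eq_two_iff_legendreSym`), while `(−3 / p) = 1 ⟺ p ≡ 1 (mod 3)` (`legendreSym_neg_three_eq_one_iff`);
so `d_K = −3` forces `p ≡ 1 (mod 3)`. Together with the `p = 3` case, the off-sliver conjunct is a genuine (free)
condition on the certificate ONLY for `p ≡ 1 (mod 3)`, `p ≥ 7`. [cite: Cox2013, §1 (1.8)] -/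
theorem twistUnitFieldOffSliverAt_of_twistUnitFieldAt_of_mod_three_eq_two {W : WeierstrassCurve ℚ} [W.IsElliptic]
    {p : ℕ} [Fact p.Prime] (hp2 : p ≠ 2) (hp3 : p % 3 = 2) (hpN : p ∣ W.conductorNorm ℤ)
    (h : TwistUnitFieldAt W p) : TwistUnitFieldOffSliverAt W p := by
  obtain ⟨K, _, _, W₂, W₂d, _, _, _, _, hK, hodd, hHH, hLd, h2, hC, hU⟩ := h
  have hp : p.Prime := Fact.out
  have hp3' : p ≠ 3 := by rintro rfl; norm_num at hp3
  have hne : NumberField.discr K ≠ -3 := by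
    intro hd
    have hsplit := hHH p hp hpN
    rw [Literature.NumberTheory.QuadraticFields.Quadratic.ncard_primesOver_eq_two_iff_legendreSym hK.1 hp2, hd,
      Literature.NumberTheory.QuadraticFields.Quadratic.legendreSym_neg_three_eq_one_iff hp2 hp3'] at hsplit
    omega
  exact ⟨K, inferInstance, inferInstance, W₂, W₂d, inferInstance, inferInstance, inferInstance, inferInstance, hK,
    hodd, hne, hHH, hLd, h2, hC, hU⟩

end Summit.BirchSwinnertonDyer.BirchSwinnertonDyer.Theorems.SchneiderFree.Upper

end
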